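import Literature.MathematicalPhysics.QuantumFieldTheory.Balaban1983to89.B9Eq33CovDerivLocalLetter
import Literature.MathematicalPhysics.QuantumFieldTheory.Balaban1983to89.B9Eq342TowerBigBlocks

/-!
# `Balaban1983to89.B9Eq33CovDerivLocalLetterTower` — T. Bałaban, *Propagators for lattice gauge theories in a background field*, Commun. Math. Phys. **99**
# (1985) 389–434 [Balaban1985BackgroundPropagators] (3.3) pp. 390–391, (3.8) p. 392, Thm 3.1 (3.42) p. 397 (*«for x ∈ Δ(y), supp λ ⊂ Δ(y′)»* with the
# UNIT blocks `Δ(y)` of the `L^k`-lattice), (3.153) p. 426: **THE (3.42)-LETTERS OF `D` AND `D*` OVER ANY BLOCK MAP WITH ADJACENT BOND ENDS, AND OVER THE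
# BIG BLOCKS OF THE TOWER** — this lineage's `B9Eq33CovDerivLocalLetter` §2 (`local_covDeriv`, `local_covDiv`, welded to `blockCoord L m` on `T_{(Lm)}`)
# RE-TYPED for an ARBITRARY block map `π : T_P → T_m` whose only letter is `d_m(π(b₋), π(b₊)) ≤ 1`, then INSTANTIATED at the big-block map
# `Π = blockCoord (L^k) m ∘ siteCast` of print's `k`-th step (`B9Eq342TowerBigBlocks`): the `D_U`∕`D*_U` letters that this lineage's
# `B9Eq3153FrakGkLocalLetter.local_letter_frakGk_of_letters` displays (pub-balaban NE9 owner's plan v10 §6 OPEN (4), tower storey)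

statement-level skeleton of published theorems with citation tags; proofs where landed; nothing here is a claim about the Yang–Mills mass gap

CITATION HEADER (lean-in-tree rule).  Audit cell `pub-balaban`, sub-cell `t4`, BINDER row NE9; filed by NE9 crux-team LEAF PROVER 03
(`b2b-balaban-t4-ne9-formalise-leaf-03`, gen 72; author lineage of both imports).  Sources READ in the held renders: [Balaban1985BackgroundPropagators] p. 390–391
(3.3), p. 392 (3.8), p. 393 (3.15)–(3.16), p. 397 (3.42); [Balaban1985Averaging] (1)–(2) p. 17.  NOTHING printed is asserted: transport bounds `M_R`, `M_S`,
the scalar `c` and the rate `κ` are DISPLAYED; [folklore] triangle inequality and one-bond range bookkeeping.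

WHAT IS PROVED (sorry-free; proof lane — no `def`).
* §1 ANY period vector `P`, ANY block map `π : TSite d P → TSite d m` with the ADJACENCY letter `hπ : ∀ b, d_m(π(b₋), π(b₊)) ≤ 1`:
  **`local_covDeriv_of_blockMap`** — for `g` supported in `π⁻¹(v)` with `‖g‖ ≤ F`: `‖(D_c^R g)(b)‖ ≤ ‖c‖·(M_R+1)·e^{κ}·e^{−κ·d_m(π(b₋), v)}·F` (`κ ≥ 0`);
  **`local_covDiv_of_blockMap`** — for `A` with `A(b) = 0` unless `π(b₋) = v`, `‖A‖ ≤ F`: `‖(D*_c^S A)(y)‖ ≤ ‖c‖·d·(M_S+1)·e^{κ}·e^{−κ·d_m(π(y), v)}·F`.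
  (`B9Eq33CovDerivLocalLetter.local_covDeriv` ∕ `local_covDiv` are the instances `π = blockCoord L m`.)
* §2 THE TOWER: **`tdist_bigBlock_bpos_btgt_le_one`** — `d_m(Π(b₋), Π(b₊)) ≤ 1` for every bond of `T_{(L^k m)}` (`B9Eq342TowerBigBlocks.mul_tdist_bigBlock_sub_le_tdist`
  + `B9Eq349BlockDistanceWeight.tdist_bpos_btgt_le_one`); **`local_covDeriv_tower`**, **`local_covDiv_tower`** — §1 at `π := Π` on `towerP L m k`.
HONEST SCOPE.  One-bond range bookkeeping; no decay is produced (`e^{κ}` pays for the rate); nothing of (3.42)∕Thm 3.1 asserted; NOT NE9 (cell pub-balaban: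
NE9 NOT PRINTED ∕ NOT PROVED; «NE9 ⇐ the named binders»; row WALLED ON A MODEL (O-NE9-1; #5 UNRULED); spine PROVED 0∕9; rung (B)+1 on a finite T⁴ — NOT
infinite volume, NOT mass gap, NOT Clay; HONEST DEPENDENCY: continuum YM on T⁴ ⇐ BetaPertH ∧ nine spine estimates (0/9 proved); BetaPertH ⇐ (D1) ∧ (D4) ∧
CAP+tail; G-an2-4 gates asym, D1 and NE2/3/4).  NEW file importing `B9Eq33CovDerivLocalLetter` and `B9Eq342TowerBigBlocks`; nothing modified.  Net new
unproved facts: 0.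
-/

noncomputable section

open scoped BigOperators

namespace Literature.MathematicalPhysics.QuantumFieldTheory.Balaban1983to89.B9Eq33CovDerivLocalLetterTower

open B4Sect5Torus (TSite tdist tdist_nonneg tdist_self tdist_symm)
open B9SectCLatticeCarrier (Bond bpos btgt unshift shift_unshift)
open B9Eq319QprimeTorus (fineP blockCoord)
open B9Eq315QTower (towerP)
open B9Eq316TowerFlatIsOneStep (towerP_eq_fineP_pow siteCast)
open B9Eq33CovDerivVector (covDeriv covDiv covDiv_apply)
open B9Eq349BlockDistanceWeight (tdist_bpos_btgt_le_one)
open B9Eq33CovDerivLocalLetter (norm_covDeriv_apply_le covDeriv_apply_eq_zero_of_ends norm_covDiv_apply_le covDiv_apply_eq_zero_of_ends)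
open B9Eq342TowerBigBlocks (mul_tdist_bigBlock_sub_le_tdist)

/-! ## §1 Any block map with adjacent bond ends -/

section BlockMap

variable {d : ℕ} {P : Fin d → ℕ} {m : Fin d → ℕ} {𝕜 : Type*} [NontriviallyNormedField 𝕜] {V : Type*} [NormedAddCommGroup V] [NormedSpace 𝕜 V]
  (π : TSite d P → TSite d m)

/-- **THE COVARIANT DERIVATIVE CARRIES (L) OVER ANY BLOCK MAP WITH ADJACENT BOND ENDS**, at every rate `κ ≥ 0`: if `d_m(π(b₋), π(b₊)) ≤ 1` for every bond, then for
`g` supported in `π⁻¹(v)` with `‖g(y)‖ ≤ F` and every bond `b`, `‖(D_c^R g)(b)‖ ≤ ‖c‖·(M_R+1)·e^{κ}·e^{−κ·d_m(π(b₋), v)}·F` (`D` vanishes unless an end of `b`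
lies in the support, and then `π(b₋)` is `v` or adjacent to it). [folklore] [cite: Balaban1985BackgroundPropagators, (3.3) pp.390-391, Thm 3.1 (3.42) p.397] -/
theorem local_covDeriv_of_blockMap (hπ : ∀ b : Bond d P, tdist m (π (bpos b)) (π (btgt b)) ≤ 1)
    (c : 𝕜) (R : Bond d P → V →ₗ[𝕜] V) {MR : ℝ} (hMR : 0 ≤ MR) (hR : ∀ b w, ‖R b w‖ ≤ MR * ‖w‖)
    {κ : ℝ} (hκ : 0 ≤ κ) (v : TSite d m) (g : TSite d P → V) (F : ℝ) (hgv : ∀ y, π y ≠ v → g y = 0) (hgF : ∀ y, ‖g y‖ ≤ F) (b : Bond d P) :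
    ‖covDeriv c R g b‖ ≤ ‖c‖ * (MR + 1) * Real.exp κ * Real.exp (-(κ * tdist m (π (bpos b)) v)) * F := by
  have hF : 0 ≤ F := (norm_nonneg _).trans (hgF (bpos b))
  have hsup := norm_covDeriv_apply_le c R hMR hR g hgF b
  have hMR1 : 0 ≤ ‖c‖ * (MR + 1) * F := mul_nonneg (mul_nonneg (norm_nonneg c) (by linarith)) hF
  have hcomp : ∀ {D : ℝ}, D ≤ 1 → ‖c‖ * (MR + 1) * F ≤ ‖c‖ * (MR + 1) * Real.exp κ * Real.exp (-(κ * D)) * F := fun {D} hD => by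
    have h1 : (1 : ℝ) ≤ Real.exp κ * Real.exp (-(κ * D)) := by
      rw [← Real.exp_add]
      exact Real.one_le_exp (by nlinarith [mul_le_mul_of_nonneg_left hD hκ])
    calc ‖c‖ * (MR + 1) * F = ‖c‖ * (MR + 1) * F * 1 := (mul_one _).symm
      _ ≤ ‖c‖ * (MR + 1) * F * (Real.exp κ * Real.exp (-(κ * D))) := mul_le_mul_of_nonneg_left h1 hMR1
      _ = ‖c‖ * (MR + 1) * Real.exp κ * Real.exp (-(κ * D)) * F := by ring
  by_cases hlo : π (bpos b) = v
  · rw [hlo, tdist_self]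
    exact hsup.trans (hcomp zero_le_one)
  · by_cases hhi : π (btgt b) = v
    · have hD : tdist m (π (bpos b)) v ≤ 1 := by rw [← hhi]; exact hπ b
      exact hsup.trans (hcomp hD)
    · rw [covDeriv_apply_eq_zero_of_ends c R g b (hgv _ hlo) (hgv _ hhi), norm_zero]
      exact mul_nonneg (mul_nonneg (mul_nonneg (mul_nonneg (norm_nonneg _) (by linarith)) (Real.exp_nonneg _)) (Real.exp_nonneg _)) hF

/-- **THE ADJOINT DERIVATIVE `D*` CARRIES (L) OVER ANY BLOCK MAP WITH ADJACENT BOND ENDS**, at every rate `κ ≥ 0`: for a bond function `A` with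
`A(b) = 0` unless `π(b₋) = v`, `‖A(b)‖ ≤ F`, and every site `y`: `‖(D*_c^S A)(y)‖ ≤ ‖c‖·d·(M_S+1)·e^{κ}·e^{−κ·d_m(π(y), v)}·F` — the `2d` bonds at `y` have
base points `y` or `y − e_μ`, whose blocks are `π(y)` or adjacent to it. [folklore] [cite: Balaban1985BackgroundPropagators, (3.8) p.392, Thm 3.1 (3.42) p.397] -/
theorem local_covDiv_of_blockMap (hm : ∀ i, 1 ≤ m i) (hπ : ∀ b : Bond d P, tdist m (π (bpos b)) (π (btgt b)) ≤ 1)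
    (c : 𝕜) (S : Bond d P → V →ₗ[𝕜] V) {MS : ℝ} (hMS : 0 ≤ MS)
    (hS : ∀ b w, ‖S b w‖ ≤ MS * ‖w‖) {κ : ℝ} (hκ : 0 ≤ κ) (v : TSite d m) (A : Bond d P → V) (F : ℝ)
    (hAv : ∀ b, π (bpos b) ≠ v → A b = 0) (hAF : ∀ b, ‖A b‖ ≤ F) (y : TSite d P) :
    ‖covDiv c S A y‖ ≤ ‖c‖ * (d * (MS + 1)) * Real.exp κ * Real.exp (-(κ * tdist m (π y) v)) * F := by
  rcases Nat.eq_zero_or_pos d with hd | hd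
  · subst hd
    rw [covDiv_apply]
    simp
  have hF : 0 ≤ F := (norm_nonneg _).trans (hAF (y, ⟨0, hd⟩))
  have hsup := norm_covDiv_apply_le c S hMS hS A hAF y
  have hK0 : 0 ≤ ‖c‖ * (d * (MS + 1)) * F := mul_nonneg (mul_nonneg (norm_nonneg c) (by positivity)) hF
  have hcomp : ∀ {D : ℝ}, D ≤ 1 → ‖c‖ * (d * (MS + 1)) * F ≤ ‖c‖ * (d * (MS + 1)) * Real.exp κ * Real.exp (-(κ * D)) * F :=
    fun {D} hD => by
    have h1 : (1 : ℝ) ≤ Real.exp κ * Real.exp (-(κ * D)) := by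
      rw [← Real.exp_add]
      exact Real.one_le_exp (by nlinarith [mul_le_mul_of_nonneg_left hD hκ])
    calc ‖c‖ * (d * (MS + 1)) * F = ‖c‖ * (d * (MS + 1)) * F * 1 := (mul_one _).symm
      _ ≤ ‖c‖ * (d * (MS + 1)) * F * (Real.exp κ * Real.exp (-(κ * D))) := mul_le_mul_of_nonneg_left h1 hK0
      _ = ‖c‖ * (d * (MS + 1)) * Real.exp κ * Real.exp (-(κ * D)) * F := by ring
  by_cases hy : π y = v
  · rw [hy, tdist_self]
    exact hsup.trans (hcomp zero_le_one)
  · by_cases hex : ∃ μ, π (unshift μ y) = v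
    · obtain ⟨μ, hμ⟩ := hex
      have hD : tdist m (π y) v ≤ 1 := by
        have h : tdist m (π (unshift μ y)) (π (B9SectCLatticeCarrier.shift μ (unshift μ y))) ≤ 1 := hπ (unshift μ y, μ)
        rw [shift_unshift] at h
        rw [← hμ, tdist_symm hm]
        exact h
      exact hsup.trans (hcomp hD)
    · simp only [not_exists] at hex
      rw [covDiv_apply_eq_zero_of_ends c S A y (fun μ => hAv (y, μ) hy) (fun μ => hAv (unshift μ y, μ) (hex μ)), norm_zero]
      exact mul_nonneg (mul_nonneg (mul_nonneg (mul_nonneg (norm_nonneg _) (by positivity)) (Real.exp_nonneg _))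
        (Real.exp_nonneg _)) hF

end BlockMap

/-! ## §2 The big blocks of the tower -/

section Tower

variable {d : ℕ} (L : ℕ) [NeZero L] (m : Fin d → ℕ) (k : ℕ) {𝕜 : Type*} [NontriviallyNormedField 𝕜] {V : Type*} [NormedAddCommGroup V]
  [NormedSpace 𝕜 V]

/-- **THE TWO ENDS OF A BOND OF `T_{(L^k m)}` LIE IN BIG BLOCKS AT UNIT-LATTICE DISTANCE `≤ 1`**: `d_m(Π(b₋), Π(b₊)) ≤ 1` with
`Π = blockCoord (L^k) m ∘ siteCast` — from `L^k·d_m(Πx, Πx′) − (L^k − 1) ≤ d(x, x′)` (`B9Eq342TowerBigBlocks`) and `d(b₋, b₊) ≤ 1`. [folklore]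
[cite: Balaban1985Averaging, (1)–(2) p.17; Balaban1985BackgroundPropagators, (3.15)–(3.16) p.393] -/
theorem tdist_bigBlock_bpos_btgt_le_one (hm : ∀ i, 1 ≤ m i) (b : Bond d (towerP L m k)) :
    tdist m (blockCoord (L ^ k) m (siteCast (towerP_eq_fineP_pow L m k) (bpos b)))
      (blockCoord (L ^ k) m (siteCast (towerP_eq_fineP_pow L m k) (btgt b))) ≤ 1 := by
  have hL1 : (1 : ℝ) ≤ L := by exact_mod_cast Nat.one_le_iff_ne_zero.mpr (NeZero.ne L)
  have hLk : (1 : ℝ) ≤ (L : ℝ) ^ k := one_le_pow₀ hL1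
  have hP : ∀ i, 1 ≤ towerP L m k i := fun i => by
    rw [towerP_eq_fineP_pow]
    exact Nat.one_le_iff_ne_zero.mpr (Nat.mul_ne_zero (pow_ne_zero k (NeZero.ne L)) (by have := hm i; omega))
  have h1 := mul_tdist_bigBlock_sub_le_tdist L m k hm (bpos b) (btgt b)
  have h2 := tdist_bpos_btgt_le_one hP b
  have h3 : (L : ℝ) ^ k * tdist m (blockCoord (L ^ k) m (siteCast (towerP_eq_fineP_pow L m k) (bpos b)))
      (blockCoord (L ^ k) m (siteCast (towerP_eq_fineP_pow L m k) (btgt b))) ≤ (L : ℝ) ^ k * 1 := by linarith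
  exact le_of_mul_le_mul_left h3 (by linarith)

/-- **`D` CARRIES (L) OVER THE BIG BLOCKS OF THE TOWER** (`Π = blockCoord (L^k) m ∘ siteCast` on `T_{(L^k m)}`), at every rate `κ ≥ 0` — §1 at the
adjacency letter `tdist_bigBlock_bpos_btgt_le_one`. [folklore] [cite: Balaban1985BackgroundPropagators, (3.3) pp.390-391, Thm 3.1 (3.42) p.397, (3.153) p.426] -/
theorem local_covDeriv_tower (hm : ∀ i, 1 ≤ m i) (c : 𝕜) (R : Bond d (towerP L m k) → V →ₗ[𝕜] V) {MR : ℝ} (hMR : 0 ≤ MR)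
    (hR : ∀ b w, ‖R b w‖ ≤ MR * ‖w‖) {κ : ℝ} (hκ : 0 ≤ κ) (v : TSite d m) (g : TSite d (towerP L m k) → V) (F : ℝ)
    (hgv : ∀ y, blockCoord (L ^ k) m (siteCast (towerP_eq_fineP_pow L m k) y) ≠ v → g y = 0) (hgF : ∀ y, ‖g y‖ ≤ F)
    (b : Bond d (towerP L m k)) :
    ‖covDeriv c R g b‖ ≤
      ‖c‖ * (MR + 1) * Real.exp κ * Real.exp (-(κ * tdist m (blockCoord (L ^ k) m (siteCast (towerP_eq_fineP_pow L m k) (bpos b))) v)) * F :=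
  local_covDeriv_of_blockMap (fun y : TSite d (towerP L m k) => blockCoord (L ^ k) m (siteCast (towerP_eq_fineP_pow L m k) y))
    (tdist_bigBlock_bpos_btgt_le_one L m k hm) c R hMR hR hκ v g F hgv hgF b

/-- **`D*` CARRIES (L) OVER THE BIG BLOCKS OF THE TOWER**, at every rate `κ ≥ 0` — §1 at the adjacency letter `tdist_bigBlock_bpos_btgt_le_one`. [folklore]
[cite: Balaban1985BackgroundPropagators, (3.8) p.392, Thm 3.1 (3.42) p.397, (3.153) p.426] -/
theorem local_covDiv_tower (hm : ∀ i, 1 ≤ m i) (c : 𝕜) (S : Bond d (towerP L m k) → V →ₗ[𝕜] V) {MS : ℝ} (hMS : 0 ≤ MS)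
    (hS : ∀ b w, ‖S b w‖ ≤ MS * ‖w‖) {κ : ℝ} (hκ : 0 ≤ κ) (v : TSite d m) (A : Bond d (towerP L m k) → V) (F : ℝ)
    (hAv : ∀ b, blockCoord (L ^ k) m (siteCast (towerP_eq_fineP_pow L m k) (bpos b)) ≠ v → A b = 0) (hAF : ∀ b, ‖A b‖ ≤ F)
    (y : TSite d (towerP L m k)) :
    ‖covDiv c S A y‖ ≤
      ‖c‖ * (d * (MS + 1)) * Real.exp κ * Real.exp (-(κ * tdist m (blockCoord (L ^ k) m (siteCast (towerP_eq_fineP_pow L m k) y)) v)) * F :=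
  local_covDiv_of_blockMap (fun y : TSite d (towerP L m k) => blockCoord (L ^ k) m (siteCast (towerP_eq_fineP_pow L m k) y)) hm
    (tdist_bigBlock_bpos_btgt_le_one L m k hm) c S hMS hS hκ v A F hAv hAF y

end Tower

end Literature.MathematicalPhysics.QuantumFieldTheory.Balaban1983to89.B9Eq33CovDerivLocalLetterTower

end
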